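import Mathlib
import Summits.ValiantsHypothesis.ValiantsHypothesis.Theorems.RigidityForcesSymmetryRankRigidMinimalReprLaplaceFiveStarLemmaKSquareMemberMain

/-!
# ValiantsHypothesis / RigidityForcesSymmetry — crux `LaplaceOptimalFive` (stmt-ValiantsHypothesis-24813), crux idea
`young-shadow` (K1) on the star: **THE T1 NORMAL FORM — SOLVING CLOSEDNESS INSIDE `⟨L², Q''⟩ ⊗ ⟨L³, L·Q''⟩`**
(memo `NOTE-p4g15-24813-K1-star.md` §4 «Solving (T1)» / §12 last paragraph; referee note §B «the normal forms of §4 … are then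
the solution of the LINEAR identity (★) inside these spans»)

After ✓ `lemma_two_prime` (T1 branch) a closed two-term tensor lives in the pencil basis `(L², Q'')` with cubics
`k₁ = L·(a₁ L² + b₁ Q'')`, `k₂ = L·(a₂ L² + b₂ Q'')`.  Closedness is the 2-form identity `d(L²)∧dk₁ + dQ''∧dk₂ = 0`
(✓ `wedge_two_form`, polarised).  `t1_normal_form`: if `Q''` is not a multiple of `L²` then

  `b₂ = 0` and `2 b₁ = 3 a₂`,

i.e. `k₂ = a₂ L³`, `k₁ = a₁ L³ + (3a₂/2) L Q''` — memo §4's `k_B = βℓ³`, `k_A = aℓ³ + (3β/2) ℓq` with `β = a₂`.  (The explicit slack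
`E = 3βℓ PᵀQP` is then a direct expansion, left to the assembly.)  Key identity (`wedge_in_square_basis`): the `(a,c)` component of the
2-form equals `(2b₁ L² − 3a₂ L² − b₂ Q'') · (λ_a ∂_cQ'' − λ_c ∂_aQ'')`.

Pure algebra; no star hypotheses, no definitions, no `sorry`.  Honest framing: helper; K1-on-the-star PAPER PASS, not kernel;
`LaplaceOptimalFive` OPEN · CONTESTED 72/120; `VP ≠ VNP` NOT proved.
-/

set_option linter.dupNamespace false

namespace Summit.ValiantsHypothesis.ValiantsHypothesis.Theorems.RigidityForcesSymmetryRankRigidMinimalRepr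

namespace LaplaceFiveStar

open Finset MvPolynomial

/-- **The 2-form in the square basis.**  With `L = Σ λ_z X_z`, `k₁ = L(C a₁ L² + C b₁ Q)`, `k₂ = L(C a₂ L² + C b₂ Q)`:
`∂_a(L²)∂_c k₁ − ∂_c(L²)∂_a k₁ + ∂_aQ ∂_c k₂ − ∂_cQ ∂_a k₂ = (C(2b₁ − 3a₂) L² − C b₂ Q)·(C λ_a ∂_cQ − C λ_c ∂_aQ)`. [folklore] -/
theorem wedge_in_square_basis (lam : Fin 5 → ℂ) (Q : MvPolynomial (Fin 5) ℂ) (a₁ b₁ a₂ b₂ : ℂ) (a c : Fin 5) :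
    let L : MvPolynomial (Fin 5) ℂ := ∑ z : Fin 5, lam z • (X z : MvPolynomial (Fin 5) ℂ)
    let k₁ : MvPolynomial (Fin 5) ℂ := L * (C a₁ * L ^ 2 + C b₁ * Q)
    let k₂ : MvPolynomial (Fin 5) ℂ := L * (C a₂ * L ^ 2 + C b₂ * Q)
    pderiv a (L ^ 2) * pderiv c k₁ - pderiv c (L ^ 2) * pderiv a k₁ + pderiv a Q * pderiv c k₂ - pderiv c Q * pderiv a k₂
      = (C (2 * b₁ - 3 * a₂) * L ^ 2 - C b₂ * Q) * (C (lam a) * pderiv c Q - C (lam c) * pderiv a Q) := by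
  classical
  intro L k₁ k₂
  have hLa : ∀ x : Fin 5, pderiv x L = C (lam x) := fun x => pderiv_sum_smul_X lam x
  simp only [k₁, k₂, pderiv_mul, Derivation.leibniz_pow, pderiv_C, hLa, map_add, map_sub, map_mul, map_ofNat, smul_eq_mul,
    zero_mul, zero_add]
  ring

/-- A quadric equal to `c · L²` as a polynomial has matrix `c · λλᵀ`. [folklore] -/
theorem tensor_of_quadric_eq_sq (U : Fin 5 → Fin 5 → ℂ) (hU : ∀ a b : Fin 5, U a b = U b a) (lam : Fin 5 → ℂ) (c : ℂ)
    (h : (∑ a : Fin 5, ∑ b : Fin 5, C (U a b) * X a * X b : MvPolynomial (Fin 5) ℂ)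
      = C c * (∑ z : Fin 5, lam z • (X z : MvPolynomial (Fin 5) ℂ)) ^ 2) (x w : Fin 5) :
    U x w = c * (lam x * lam w) := by
  have hsq : (∑ z : Fin 5, lam z • (X z : MvPolynomial (Fin 5) ℂ)) ^ 2
      = ∑ a : Fin 5, ∑ b : Fin 5, C (lam a * lam b) * X a * X b := by
    rw [sq, Finset.sum_mul_sum]
    refine Finset.sum_congr rfl fun a _ => Finset.sum_congr rfl fun b _ => ?_
    rw [smul_eq_C_mul, smul_eq_C_mul, map_mul]; ring
  have hdiff : (∑ a : Fin 5, ∑ b : Fin 5, C (U a b - c * (lam a * lam b)) * X a * X b : MvPolynomial (Fin 5) ℂ) = 0 := by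
    have e : ∀ a b : Fin 5, (C (U a b - c * (lam a * lam b)) * X a * X b : MvPolynomial (Fin 5) ℂ)
        = C (U a b) * X a * X b - C c * (C (lam a * lam b) * X a * X b) := fun a b => by
      rw [map_sub, map_mul]; ring
    simp only [e, Finset.sum_sub_distrib, ← Finset.mul_sum]
    rw [← hsq, h, sub_self]
  have h0 := quadric_tensor_eq_zero (fun a b => U a b - c * (lam a * lam b))
    (fun a b => by show U a b - c * (lam a * lam b) = U b a - c * (lam b * lam a); rw [hU a b]; ring) hdiff x w
  exact sub_eq_zero.mp h0

/-- **T1 normal form.**  `L = Σ λ_z X_z` with `λ_{z₀} ≠ 0`, `Q = Σ C(U a b) X_a X_b` symmetric and NOT a multiple of `L²`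
(`U ≠ c·λλᵀ` for all `c`), cubics `k₁ = L(C a₁ L² + C b₁ Q)`, `k₂ = L(C a₂ L² + C b₂ Q)` with
`d(L²)∧dk₁ + dQ∧dk₂ = 0`.  Then `b₂ = 0` and `2 b₁ = 3 a₂`. [folklore] -/
theorem t1_normal_form (lam : Fin 5 → ℂ) (z₀ : Fin 5) (hlam : lam z₀ ≠ 0)
    (U : Fin 5 → Fin 5 → ℂ) (hU : ∀ a b : Fin 5, U a b = U b a) (hnsq : ∀ c : ℂ, ¬ ∀ x w : Fin 5, U x w = c * (lam x * lam w))
    (Q : MvPolynomial (Fin 5) ℂ) (hQ : Q = ∑ a : Fin 5, ∑ b : Fin 5, C (U a b) * X a * X b)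
    (a₁ b₁ a₂ b₂ : ℂ)
    (hw : ∀ a c : Fin 5,
      let L : MvPolynomial (Fin 5) ℂ := ∑ z : Fin 5, lam z • (X z : MvPolynomial (Fin 5) ℂ)
      let k₁ : MvPolynomial (Fin 5) ℂ := L * (C a₁ * L ^ 2 + C b₁ * Q)
      let k₂ : MvPolynomial (Fin 5) ℂ := L * (C a₂ * L ^ 2 + C b₂ * Q)
      pderiv a (L ^ 2) * pderiv c k₁ - pderiv c (L ^ 2) * pderiv a k₁ + pderiv a Q * pderiv c k₂ - pderiv c Q * pderiv a k₂ = 0) :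
    b₂ = 0 ∧ 2 * b₁ = 3 * a₂ := by
  classical
  set L : MvPolynomial (Fin 5) ℂ := ∑ z : Fin 5, lam z • (X z : MvPolynomial (Fin 5) ℂ) with hL
  -- some `N_{ac} = C λ_a ∂_cQ − C λ_c ∂_aQ` is non-zero (else `U ∝ λλᵀ`)
  have hN : ∃ a c : Fin 5, C (lam a) * pderiv c Q - C (lam c) * pderiv a Q ≠ 0 := by
    by_contra h
    simp only [not_exists, not_not] at h
    apply hnsq (U z₀ z₀ / (lam z₀ * lam z₀))
    -- evaluate `N_{a z₀}` at `e_w`: `λ_a U_{z₀ w} = λ_{z₀} U_{a w}`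
    have hcoef : ∀ a w : Fin 5, lam a * U z₀ w = lam z₀ * U a w := by
      intro a w
      have e := congr_arg (MvPolynomial.eval (Pi.single w (1 : ℂ))) (h a z₀)
      rw [map_sub, map_mul, map_mul, eval_C, eval_C, map_zero, hQ, eval_pderiv_quadric U hU, eval_pderiv_quadric U hU] at e
      simp [Pi.single_apply] at e
      linear_combination e / 2
    intro x w
    have h1 := hcoef x w
    have h2 := hcoef w z₀
    rw [hU z₀ w] at h1
    field_simp
    -- `λ₀² U x w = U₀₀ λ_x λ_w`
    have h3 : lam z₀ * (lam z₀ * U x w) = lam z₀ * (lam x * U w z₀) := by rw [← h1]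
    have h4 : lam z₀ * U w z₀ = lam w * U z₀ z₀ := by linear_combination -h2
    linear_combination h3 + lam x * h4
  obtain ⟨a, c, hNac⟩ := hN
  have key := wedge_in_square_basis lam Q a₁ b₁ a₂ b₂ a c
  have hw' := hw a c
  simp only at key hw'
  rw [hw'] at key
  -- `(C(2b₁ − 3a₂) L² − C b₂ Q) = 0`
  have hfac : C (2 * b₁ - 3 * a₂) * L ^ 2 - C b₂ * Q = 0 := by
    rcases mul_eq_zero.mp key.symm with h | h
    · exact h
    · exact absurd h hNac
  by_cases hb₂ : b₂ = 0
  · refine ⟨hb₂, ?_⟩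
    rw [hb₂, C_0, zero_mul, sub_zero] at hfac
    have hL0 : L ≠ 0 := by
      intro h0
      have := (Literature.RingTheory.MvPolynomial.sum_smul_X_eq_zero_iff lam).mp h0
      exact hlam (by rw [this]; rfl)
    have hc : C (2 * b₁ - 3 * a₂) = (0 : MvPolynomial (Fin 5) ℂ) :=
      (mul_eq_zero.mp hfac).resolve_right (pow_ne_zero 2 hL0)
    rw [C_eq_zero] at hc
    linear_combination hc
  · exfalso
    apply hnsq ((2 * b₁ - 3 * a₂) / b₂)
    have hQe : (∑ a : Fin 5, ∑ b : Fin 5, C (U a b) * X a * X b : MvPolynomial (Fin 5) ℂ) = C ((2 * b₁ - 3 * a₂) / b₂) * L ^ 2 := by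
      rw [← hQ]
      have hb : (C b₂ : MvPolynomial (Fin 5) ℂ) ≠ 0 := by rw [Ne, C_eq_zero]; exact hb₂
      apply mul_left_cancel₀ hb
      rw [← mul_assoc, ← map_mul, mul_div_cancel₀ _ hb₂]
      linear_combination -hfac
    exact tensor_of_quadric_eq_sq U hU lam _ hQe

end LaplaceFiveStar

end Summit.ValiantsHypothesis.ValiantsHypothesis.Theorems.RigidityForcesSymmetryRankRigidMinimalRepr
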